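import Summits.QuantumAdvantage.QuantumAdvantage.Theorems.FlatDialCircuit

/-!
# FlatDialSearch — module 3/3 of the FlatDial THEOREMS package (cell decomp-qadv, lens-3 generation 11)

§6 the solver set `flatReaders` (families computing the flat readout `¬ρ` for EVERY valid certificate) and ★ THE ONE EQUIV of the node in
hardness form: `no_flatReadout_iff_no_signer` — modulo the normality side condition `N` («the `G` of every exact pair has a flat»),
«no table-level `AC⁰[⊕]` family computes the flat readout» ⟺ «no table-level `AC⁰[⊕]` family signs the slice» (`readsFlats_of_signsTable`
unconditional, `signsTable_of_readsFlats` under `N`).  §7 the finder sets `pairFinders` / `finders` (a valid flat certificate of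
`G` from both tables / from the table of `G` alone) and the NECESSITY chain ★ `no_finder_of_no_flatReadout` (finder + readout layer =
readout solver, by `realisable_rho` and `rho_wellDefined`), `no_finder_of_no_signer` (mod `N`).  §8 the split lands on 27991's statement:
`signedSlice_not_mem_promiseLift_of_split`.  §9 THE ATTACK SCHEMA: `not_acRealOver_mod3` (Smolensky, function form), `FlatRecovery`
(literal plantings whose EVERY flat leaks `MOD₃`), ★ `no_finder_of_recovery`.

Provenance: farm-checked node file `FlatDial.lean` (HOME/decomp-qadv-lens-3/g11/; rc 0 · 0 sorry · axioms ⊆ {propext, Classical.choice,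
Quot.sound}); record HOME/decomp-qadv-lens-3/g11/NODE-g11.md.  Modules: FlatDialReadout → FlatDialCircuit → FlatDialSearch (each imports its
predecessor).  Namespace `Summit.QuantumAdvantage.QuantumAdvantage.Theorems.FlatDial`.  Uses the landed HintDial package BY NAME (`HintDial.bit*`, `isDualOf_of_forrelation_eq_one`,
`HintDial.Automaton.bd`, `HintDial.Automaton.IsLit/IsProj/evalLit/lenB`, `acRealOver_evalLit`) ; nothing of it is restated.  ZERO `def … : Prop`:
every predicate is a `Set` with an `Iff.rfl` membership lemma (`halfSpaces`, `affineSlopes`, `weaklyNormal`, `validCerts`, `hasFlatCert`,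
`realisable`, `realisableOut`, `signers`, `flatReaders`, `pairFinders`, `realisableOutG`, `signedCubicDuals`, `finders`), and the node's pieces
`T_tab`, `T'`, `N`, `W`, `L`, `A_W` are spelled INLINE in the theorems (a route file defines the items as one-liners over these sets).
-/

set_option linter.dupNamespace false

noncomputable section

namespace Summit.QuantumAdvantage.QuantumAdvantage.Theorems.FlatDial

open Finset
open Literature.Computability.Complexity
open Literature.Computability.QuantumComplexity
open Literature.Computability.MetaComplexity
open _root_.Computability (encodeNat)
open Literature.Computability.QuantumComplexity.BuzetChailloux (bxor zeroVec bxor_self bxor_bxor_cancel_left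
  twist_bxor_right twist_zeroVec_right)
open Literature.Computability.QuantumComplexity.Simon (twist_eq_one_or twist_mul_self)
open Literature.Computability.QuantumComplexity.DerivativeWalsh (W twist_bxor_left card_mul_sum_coset
  perp_perp_eq_of_sq all_eq_of_sum_eq_card)
open Summit.QuantumAdvantage.QuantumAdvantage.Theorems.HintDial (IsDualOf isDualOf_of_forrelation_eq_one
  forrelation_eq_one_of_isDualOf bit_xor bit_and bit_not bit_eq_ite bit_injective bit_decide_odd eval_bit)
open Literature.Computability.QuantumComplexity.CubicForm (bit)
open Summit.QuantumAdvantage.QuantumAdvantage.Theorems.HintDial.Automaton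

/-! ## §6 THE FLAT-READOUT SOLVER PREDICATE and THE ONE EQUIV (modulo normality) -/

/-- ★ THE FLAT READERS: families `D` that, on every exact pair of even arity and EVERY valid flat certificate `c` of its `G`, output
`¬ρ(I,c)`.  The node's `T'` («FlatRung») is `¬ ∃ D ∈ realisable, D ∈ flatReaders`.  [language: bent-function normality,
Carlet 2020 §6.1.21 / Def. 28; consistency of the requirement = `rho_wellDefined`] [cite: Carlet2020, Def. 28] -/
def flatReaders : Set ((n : ℕ) → (Fin (tabN n) → Bool) → Bool) :=
  {D | ∀ (n : ℕ) (w : Fin (tabN n) → Bool), Even n → ((pairOf n w).value = 1 ∨ (pairOf n w).value = -1) →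
    ∀ c : CertIdx n → Bool, c ∈ validCerts (pairOf n w).G.eval → D n w = !rho (pairOf n w) c}

/-- Membership in `flatReaders` unfolded. -/
theorem mem_flatReaders {D : (n : ℕ) → (Fin (tabN n) → Bool) → Bool} : D ∈ flatReaders ↔
    ∀ (n : ℕ) (w : Fin (tabN n) → Bool), Even n → ((pairOf n w).value = 1 ∨ (pairOf n w).value = -1) →
      ∀ c : CertIdx n → Bool, c ∈ validCerts (pairOf n w).G.eval → D n w = !rho (pairOf n w) c := Iff.rfl

/-- ★ EQUIV, unconditional half in solver form (kernel): a family that SIGNS the slice COMPUTES the flat readout (`rho_eq_false_iff`,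
`rho_eq_true_iff`). -/
theorem readsFlats_of_signsTable {D : (n : ℕ) → (Fin (tabN n) → Bool) → Bool} (h : D ∈ signers) : D ∈ flatReaders := by
  intro n w hn hv c hc
  rcases hv with h1 | h1
  · rw [(h n w hn).1 h1, (rho_eq_false_iff hn (Or.inl h1) hc).2 h1]; rfl
  · rw [(h n w hn).2 h1, (rho_eq_true_iff hn (Or.inr h1) hc).2 h1]; rfl

/-- ★ EQUIV, other half (kernel, modulo the normality side condition `N`): if the `G` of every exact pair of even arity HAS a flat
certificate, a family that computes the flat readout SIGNS the slice (`signOf_rho`). -/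
theorem signsTable_of_readsFlats {D : (n : ℕ) → (Fin (tabN n) → Bool) → Bool}
    (hN : ∀ I : CubicANFPair, Even I.n → (I.value = 1 ∨ I.value = -1) → I.G.eval ∈ hasFlatCert I.n) (h : D ∈ flatReaders) :
    D ∈ signers := by
  intro n w hn
  refine ⟨fun h1 => ?_, fun h1 => ?_⟩
  · obtain ⟨c, hc⟩ := hN (pairOf n w) hn (Or.inl h1)
    rw [h n w hn (Or.inl h1) c hc, (rho_eq_false_iff hn (Or.inl h1) hc).2 h1]; rfl
  · obtain ⟨c, hc⟩ := hN (pairOf n w) hn (Or.inr h1)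
    rw [h n w hn (Or.inr h1) c hc, (rho_eq_true_iff hn (Or.inr h1) hc).2 h1]; rfl

/-- `T' → T_tab` in hardness form (unconditional). -/
theorem no_signer_of_no_flatReadout
    (h : ¬ ∃ D : (n : ℕ) → (Fin (tabN n) → Bool) → Bool, D ∈ realisable ∧ D ∈ flatReaders) :
    ¬ ∃ D : (n : ℕ) → (Fin (tabN n) → Bool) → Bool, D ∈ realisable ∧ D ∈ signers :=
  fun ⟨D, hD, hs⟩ => h ⟨D, hD, readsFlats_of_signsTable hs⟩

/-- ★ THE ONE EQUIV of the node, in hardness form: modulo normality, «no table-level `AC⁰[⊕]` family computes the flat readout» ⟺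
«no table-level `AC⁰[⊕]` family signs the slice». -/
theorem no_flatReadout_iff_no_signer
    (hN : ∀ I : CubicANFPair, Even I.n → (I.value = 1 ∨ I.value = -1) → I.G.eval ∈ hasFlatCert I.n) :
    (¬ ∃ D : (n : ℕ) → (Fin (tabN n) → Bool) → Bool, D ∈ realisable ∧ D ∈ flatReaders) ↔
      (¬ ∃ D : (n : ℕ) → (Fin (tabN n) → Bool) → Bool, D ∈ realisable ∧ D ∈ signers) :=
  ⟨no_signer_of_no_flatReadout, fun h ⟨D, hD, hr⟩ => h ⟨D, hD, signsTable_of_readsFlats hN hr⟩⟩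

/-! ## §7 FLAT FINDERS and the necessity chain `T' → W_PG → W` (kernel) -/

/-- THE PAIR FINDERS: certificate maps `c` that, on every exact pair of even arity whose `G` has a flat, output a valid flat certificate
of `G` from BOTH tables.  The node's `W_PG` is `¬ ∃ c ∈ realisableOut CertIdx, c ∈ pairFinders`. [cite: Carlet2020, Def. 28] -/
def pairFinders : Set ((n : ℕ) → (Fin (tabN n) → Bool) → CertIdx n → Bool) :=
  {c | ∀ (n : ℕ) (w : Fin (tabN n) → Bool), Even n → ((pairOf n w).value = 1 ∨ (pairOf n w).value = -1) →
    (pairOf n w).G.eval ∈ hasFlatCert n → c n w ∈ validCerts (pairOf n w).G.eval}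

/-- Membership in `pairFinders` unfolded. -/
theorem mem_pairFinders {c : (n : ℕ) → (Fin (tabN n) → Bool) → CertIdx n → Bool} : c ∈ pairFinders ↔
    ∀ (n : ℕ) (w : Fin (tabN n) → Bool), Even n → ((pairOf n w).value = 1 ∨ (pairOf n w).value = -1) →
      (pairOf n w).G.eval ∈ hasFlatCert n → c n w ∈ validCerts (pairOf n w).G.eval := Iff.rfl

/-- ★ finder + readout layer = flat-readout solver (correctness): by `rho_wellDefined` it does not matter WHICH valid certificate the
finder returns. -/
theorem readsFlats_of_findsFlatsPair {c : (n : ℕ) → (Fin (tabN n) → Bool) → CertIdx n → Bool} (h : c ∈ pairFinders) :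
    (fun n w => !rho (pairOf n w) (c n w)) ∈ flatReaders := by
  intro n w hn hv c' hc'
  have hcv : c n w ∈ validCerts (pairOf n w).G.eval := h n w hn hv (mem_hasFlatCert.2 ⟨c', hc'⟩)
  show (!rho (pairOf n w) (c n w)) = !rho (pairOf n w) c'
  rw [rho_wellDefined hn hv hcv hc']

/-- `T' → W_PG` in hardness form (kernel; realisability by `realisable_rho`, `+5` layers). -/
theorem no_pairFinder_of_no_flatReadout
    (h : ¬ ∃ D : (n : ℕ) → (Fin (tabN n) → Bool) → Bool, D ∈ realisable ∧ D ∈ flatReaders) :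
    ¬ ∃ c : (n : ℕ) → (Fin (tabN n) → Bool) → CertIdx n → Bool, c ∈ realisableOut CertIdx ∧ c ∈ pairFinders :=
  fun ⟨_, hc, hf⟩ => h ⟨_, realisable_not (realisable_rho hc), readsFlats_of_findsFlatsPair hf⟩

section GOnly

variable (n : ℕ)

/-- The cubic form read from a ONE-FORM table vector. -/
def gformOf (u : Fin (formN n) → Bool) : CubicForm n :=
  ⟨u (formEquiv n none), fun i j l => u (formEquiv n (some (i, j, l)))⟩

/-- The `G`-table of a pair table. -/
def gtabOf (w : Fin (tabN n) → Bool) : Fin (formN n) → Bool := fun k => w (tabEquiv n (true, (formEquiv n).symm k))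

/-- The `G`-table of a pair table presents the pair's `G`. -/
theorem gformOf_gtabOf (w : Fin (tabN n) → Bool) : gformOf n (gtabOf n w) = formOf n true w := by
  simp [gformOf, gtabOf, formOf, Equiv.symm_apply_apply]

variable {n}

/-- THE one-form-table-level `AC⁰[⊕]` families of multi-output functions. [cite: Vollmer1999, §1.2] -/
def realisableOutG (κ : ℕ → Type) : Set ((n : ℕ) → (Fin (formN n) → Bool) → κ n → Bool) :=
  {E | ∃ d : ℕ, ∃ r : Polynomial ℕ, ∀ n k, ACRealOver (accBasis 2) (fun u => E n u k) d (r.eval n)}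

/-- Membership in `realisableOutG` unfolded. -/
theorem mem_realisableOutG {κ : ℕ → Type} {E : (n : ℕ) → (Fin (formN n) → Bool) → κ n → Bool} :
    E ∈ realisableOutG κ ↔ ∃ d : ℕ, ∃ r : Polynomial ℕ, ∀ n k, ACRealOver (accBasis 2) (fun u => E n u k) d (r.eval n) := Iff.rfl

/-- ★ THE SIGNED DUALS OF CUBIC FORMS: `G ⊕ b = F̃` for some cubic bent `F` and bit `b`, i.e. `(F, G)` is an exact pair — the promise
of the one-table search problem (it mentions no partner table: the finder never sees `F`). [cite: Carlet2020, Def. 6.1.2] -/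
def signedCubicDuals (n : ℕ) : Set ((Fin n → Bool) → Bool) :=
  {G | ∃ F : CubicForm n, forrelation F.eval G = 1 ∨ forrelation F.eval G = -1}

/-- Membership in `signedCubicDuals` unfolded. -/
theorem mem_signedCubicDuals {n : ℕ} {G : (Fin n → Bool) → Bool} :
    G ∈ signedCubicDuals n ↔ ∃ F : CubicForm n, forrelation F.eval G = 1 ∨ forrelation F.eval G = -1 := Iff.rfl

end GOnly

/-- ★ THE FINDERS: certificate maps `c` that, reading THE TABLE OF `G` ALONE, output a valid flat certificate on every weakly-normal
signed cubic dual `G` of even arity.  The node's WEAKER piece `W` («FlatSearchHard») is `¬ ∃ c ∈ realisableOutG CertIdx, c ∈ finders` — a SEARCH lower bound with short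
verifiable witnesses about ONE bent function (no partner table, no sign, no promise gap). [cite: Carlet2020, Def. 28] -/
def finders : Set ((n : ℕ) → (Fin (formN n) → Bool) → CertIdx n → Bool) :=
  {c | ∀ (n : ℕ) (u : Fin (formN n) → Bool), Even n → (gformOf n u).eval ∈ signedCubicDuals n →
    (gformOf n u).eval ∈ hasFlatCert n → c n u ∈ validCerts (gformOf n u).eval}

/-- Membership in `finders` unfolded. -/
theorem mem_finders {c : (n : ℕ) → (Fin (formN n) → Bool) → CertIdx n → Bool} : c ∈ finders ↔
    ∀ (n : ℕ) (u : Fin (formN n) → Bool), Even n → (gformOf n u).eval ∈ signedCubicDuals n →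
      (gformOf n u).eval ∈ hasFlatCert n → c n u ∈ validCerts (gformOf n u).eval := Iff.rfl

/-- Reading the `G`-half of a pair table costs nothing (a projection, depth `+0`). -/
theorem realisableOut_of_realisableOutG {c : (n : ℕ) → (Fin (formN n) → Bool) → CertIdx n → Bool} (hc : c ∈ realisableOutG CertIdx) :
    (fun n w => c n (gtabOf n w)) ∈ realisableOut CertIdx := by
  obtain ⟨d, r, hc⟩ := hc
  refine mem_realisableOut.2 ⟨d, r, fun n k => ?_⟩
  have hcomp := ACRealOver.comp (hc n k) (f := fun k' (w : Fin (tabN n) → Bool) => w (tabEquiv n (true, (formEquiv n).symm k')))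
    (fun k' => acRealOver_input (accBasis 2) _)
  exact (hcomp.mono le_rfl (by simp)).congr fun w => rfl

/-- A `G`-only finder is a pair finder. -/
theorem findsFlatsPair_of_findsFlats {c : (n : ℕ) → (Fin (formN n) → Bool) → CertIdx n → Bool} (h : c ∈ finders) :
    (fun n w => c n (gtabOf n w)) ∈ pairFinders := by
  intro n w hn hv hhas
  have hG : (gformOf n (gtabOf n w)).eval = (pairOf n w).G.eval := by rw [gformOf_gtabOf]; rfl
  have hsd : (gformOf n (gtabOf n w)).eval ∈ signedCubicDuals n :=
    mem_signedCubicDuals.2 ⟨formOf n false w, by rw [hG]; exact hv⟩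
  have := h n (gtabOf n w) hn hsd (by rw [hG]; exact hhas)
  show c n (gtabOf n w) ∈ validCerts (pairOf n w).G.eval
  rwa [hG] at this

/-- `W_PG → W` in hardness form (kernel). -/
theorem no_finder_of_no_pairFinder
    (h : ¬ ∃ c : (n : ℕ) → (Fin (tabN n) → Bool) → CertIdx n → Bool, c ∈ realisableOut CertIdx ∧ c ∈ pairFinders) :
    ¬ ∃ c : (n : ℕ) → (Fin (formN n) → Bool) → CertIdx n → Bool, c ∈ realisableOutG CertIdx ∧ c ∈ finders :=
  fun ⟨_, hc, hf⟩ => h ⟨_, realisableOut_of_realisableOutG hc, findsFlatsPair_of_findsFlats hf⟩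

/-- ★ NECESSITY `T' → W` (kernel): hardness of the flat readout implies hardness of flat SEARCH from the table of `G`. -/
theorem no_finder_of_no_flatReadout
    (h : ¬ ∃ D : (n : ℕ) → (Fin (tabN n) → Bool) → Bool, D ∈ realisable ∧ D ∈ flatReaders) :
    ¬ ∃ c : (n : ℕ) → (Fin (formN n) → Bool) → CertIdx n → Bool, c ∈ realisableOutG CertIdx ∧ c ∈ finders :=
  no_finder_of_no_pairFinder (no_pairFinder_of_no_flatReadout h)

/-- ★ NECESSITY of `W` for the sign problem (kernel, modulo normality): `N → T_tab → W`. -/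
theorem no_finder_of_no_signer
    (hN : ∀ I : CubicANFPair, Even I.n → (I.value = 1 ∨ I.value = -1) → I.G.eval ∈ hasFlatCert I.n)
    (h : ¬ ∃ D : (n : ℕ) → (Fin (tabN n) → Bool) → Bool, D ∈ realisable ∧ D ∈ signers) :
    ¬ ∃ c : (n : ℕ) → (Fin (formN n) → Bool) → CertIdx n → Bool, c ∈ realisableOutG CertIdx ∧ c ∈ finders :=
  no_finder_of_no_flatReadout ((no_flatReadout_iff_no_signer hN).2 h)

/-! ## §8 THE SPLIT lands on the statement of item 27991 (no use of `N`) -/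

/-- ★ `W, L ⊢ T`: flat-search hardness (`W`) and the search-to-decision lift (`L : W → T'`, the node's declared residual) give the
non-uniform `AC⁰[⊕]` rung of route AnfPresentation — through `T' → T_tab → T`, normality NOT used. -/
theorem signedSlice_not_mem_promiseLift_of_split
    (w : ¬ ∃ c : (n : ℕ) → (Fin (formN n) → Bool) → CertIdx n → Bool, c ∈ realisableOutG CertIdx ∧ c ∈ finders)
    (ℓ : (¬ ∃ c : (n : ℕ) → (Fin (formN n) → Bool) → CertIdx n → Bool, c ∈ realisableOutG CertIdx ∧ c ∈ finders) →
      ¬ ∃ D : (n : ℕ) → (Fin (tabN n) → Bool) → Bool, D ∈ realisable ∧ D ∈ flatReaders) :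
    SignedExactCubicSliceANF ∉ promiseLift (AC0Mod 2) :=
  signedSlice_not_mem_promiseLift_of_no_signer (no_signer_of_no_flatReadout (ℓ w))

/-! ## §9 THE ATTACK SCHEMA FOR `W` (kernel): planted literal families whose every flat leaks `MOD₃` refute every flat finder -/

/-- Smolensky for functions of bit vectors: NO constant-depth polynomial-size family over `{¬,∧,∨,MOD₂}` computes `[#₁(w) ≡ 0 (mod 3)]`
on every input length (tree: `Smolensky1987_modq_not_mem_AC0Mod_holds 2 3`, fully proved). -/
theorem not_acRealOver_mod3 : ¬ ∃ (d : ℕ) (r : Polynomial ℕ), ∀ m, ACRealOver (accBasis 2)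
    (fun w : Fin m → Bool => decide (GateFn.numOnes w % 3 = 0)) d (r.eval m) := by
  rintro ⟨d, r, h⟩
  apply Smolensky1987_modq_not_mem_AC0Mod_holds 2 3 Nat.prime_two Nat.prime_three (by decide)
  choose D hD using fun m => (h m).toCircuit
  refine ⟨d, r, D, fun m => ⟨(hD m).1, (hD m).2.1, (hD m).2.2.1⟩, fun x => ?_⟩
  rw [(hD x.length).2.2.2 x.get]
  beta_reduce
  by_cases h3 : GateFn.numOnes x.get % 3 = 0
  · rw [decide_eq_true h3]; symm; rw [← Set.mem_iff_boolIndicator]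
    show x.count true % 3 = 0
    rwa [Smolensky.count_true_eq_numOnes_get]
  · rw [decide_eq_false h3]; symm; rw [← Set.notMem_iff_boolIndicator]
    show ¬ x.count true % 3 = 0
    rwa [Smolensky.count_true_eq_numOnes_get]

/-- ★ A FLAT-RECOVERY FAMILY — the specification of the ATTACK leaf of `W`.  For every seed length `m`: a weakly-normal signed cubic
dual `G_w` of even arity `N(m) ≤ P(m)` whose TABLE BITS ARE LITERALS of the seed `w ∈ {0,1}^m` (a literal planting, as in HintDial /
`not_promiseLift_AC0Mod_of_proj`), together with an `AC⁰[⊕]` EXTRACTOR `E` that recovers `MOD₃(w)` from the seed and ANY valid flat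
certificate of `G_w` (field `recover`: EVERY flat leaks — the finder chooses the flat, so no flat may be cheap).  `hE` is the
composition-closed realisability of `E` (what `ACRealOver.comp` yields for an explicit extractor).  UNFRAMED Maiorana–McFarland plantings
are NOT recovery families (their `x'`-direction flats have literal certificates); candidate designs hide the `M`-subspace behind a
unitriangular literal frame, where flat search contains `𝔽₂`-matrix inversion (§H). -/
structure FlatRecovery where
  /-- arity of the planted function for seed length `m` -/
  N : ℕ → ℕ
  /-- polynomial arity bound -/
  P : Polynomial ℕ
  /-- the arity is polynomially bounded -/
  hN : ∀ m, N m ≤ P.eval m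
  /-- the arity is even -/
  even : ∀ m, Even (N m)
  /-- the table of the planted `G_w` -/
  plant : (m : ℕ) → (Fin m → Bool) → Fin (formN (N m)) → Bool
  /-- every table bit is a literal of the seed -/
  lit : ∀ m k, IsLit fun w => plant m w k
  /-- the planted function is a signed cubic dual -/
  dual : ∀ m w, (gformOf (N m) (plant m w)).eval ∈ signedCubicDuals (N m)
  /-- the planted function has a flat -/
  normal : ∀ m w, (gformOf (N m) (plant m w)).eval ∈ hasFlatCert (N m)
  /-- the extractor -/
  E : (m : ℕ) → (Fin m → Bool) → (CertIdx (N m) → Bool) → Bool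
  /-- extractor depth -/
  dE : ℕ
  /-- extractor size polynomial -/
  rE : Polynomial ℕ
  /-- composition-closed realisability of the extractor -/
  hE : ∀ (m : ℕ) (c : (Fin m → Bool) → CertIdx (N m) → Bool) (dc sc : ℕ),
    (∀ k, ACRealOver (accBasis 2) (fun w => c w k) dc sc) →
      ACRealOver (accBasis 2) (fun w => E m w (c w)) (dE + dc) (rE.eval m * (sc + 1))
  /-- EVERY valid flat of the planted function leaks `MOD₃` of the seed -/
  recover : ∀ (m : ℕ) (w : Fin m → Bool) (c : CertIdx (N m) → Bool),
    c ∈ validCerts (gformOf (N m) (plant m w)).eval → E m w c = decide (GateFn.numOnes w % 3 = 0)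

/-- ★★ THE ATTACK SCHEMA (kernel): a flat-recovery family refutes every `AC⁰[⊕]` flat finder reading the table of `G` (finder ∘ literal
planting ∘ extractor would compute `MOD₃` in constant depth and polynomial size, contradicting Smolensky). -/
theorem no_finder_of_recovery (R : FlatRecovery) :
    ¬ ∃ c : (n : ℕ) → (Fin (formN n) → Bool) → CertIdx n → Bool, c ∈ realisableOutG CertIdx ∧ c ∈ finders := by
  rintro ⟨c, ⟨d, r, hc⟩, hvalid⟩
  apply not_acRealOver_mod3
  -- inner: the certificate bits as functions of the seed
  have hinner : ∀ m k, ACRealOver (accBasis 2) (fun w : Fin m → Bool => c (R.N m) (R.plant m w) k) (d + 1)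
      (r.eval (R.N m) + formN (R.N m)) := by
    intro m k
    choose ℓ hℓ using fun k' => R.lit m k'
    have h := ACRealOver.comp (hc (R.N m) k) (f := fun k' (w : Fin m → Bool) => R.plant m w k') (d := 1) (s := fun _ => 1)
      (fun k' => (acRealOver_evalLit 2 (ℓ k')).congr fun w => (hℓ k' w).symm)
    refine h.mono le_rfl (le_of_eq ?_)
    simp [formN]
  refine ⟨R.dE + (d + 1), R.rE * (r.comp R.P + R.P ^ 3 + 2), fun m => ?_⟩
  have hE := R.hE m (fun w => c (R.N m) (R.plant m w)) (d + 1) (r.eval (R.N m) + formN (R.N m)) (hinner m)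
  refine (hE.mono le_rfl ?_).congr fun w => R.recover m w _ (hvalid (R.N m) (R.plant m w) (R.even m) (R.dual m w) (R.normal m w))
  have h1 : r.eval (R.N m) ≤ (r.comp R.P).eval m := by rw [Polynomial.eval_comp]; exact natPoly_eval_mono r (R.hN m)
  have h2 : formN (R.N m) ≤ (R.P.eval m) ^ 3 + 1 := by
    rw [formN_eq]; exact Nat.add_le_add_right (Nat.pow_le_pow_left (R.hN m) 3) 1
  have h3 : r.eval (R.N m) + formN (R.N m) + 1 ≤ (r.comp R.P + R.P ^ 3 + 2).eval m := by
    simp only [Polynomial.eval_add, Polynomial.eval_pow, Polynomial.eval_ofNat] at *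
    omega
  simpa [Polynomial.eval_mul] using Nat.mul_le_mul_left (R.rE.eval m) h3

end Summit.QuantumAdvantage.QuantumAdvantage.Theorems.FlatDial

end
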